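import Summits.RiemannHypothesis.RiemannHypothesis.Theses.NbGhostOfThePole
import HarnessLib

/-!
# Route NbGhostOfThePole (L34 «GHOST OF THE POLE») — `Assembly` (item stmt-RiemannHypothesis-22978)

`GhostZeroDisc → TrivialGainLaw → SharpZeroFloor → GhostOfThePoleLaw`: conjunct (ii) of the law IS
`TrivialGainLaw`; for conjunct (i), given `ε > 0` put `δ = min (1/8) (ε/(8π))` and take `M ≥ M₀, 2, ⌈exp((2π+1)/δ)⌉`,
so that `log M ≥ (2π+1)/δ`; the ghost zero `ρ` of `ζ_M` in the Rouché disc `|ρ − (1 + 2πi/log M)| < 1/(2 log M)`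
then satisfies `‖ρ − 1‖ < δ`, hence `Re ρ > 1 − δ ≥ 7/8 > 1/2` and `‖ρ‖ ≤ 1 + δ`, and the sharp floor
`2π(2 Re ρ − 1)/‖ρ‖² ≥ 2π(1 − 2δ)/(1 + δ)² ≥ 2π(1 − 4δ) ≥ 2π − ε` is below the distance by `SharpZeroFloor`.
Port of the planner's kernel-checked `assembly_holds` (rh-idea-3 g0, pub/ideators/rh-idea-3/own2/Sketch4.lean
sha16 6bf12f1653269c0b, ≈ 70 lines, compressed), typed by the route decl (route file sha16 1f50c62a568393a3).
RH-FREE limit law inside the Báez-Duarte distance; the cruxes are consumed only as hypotheses; RH is not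
proved by this; nothing here bears on the truth of RH.
-/

-- D-0017: `Summit.RiemannHypothesis.RiemannHypothesis.…` duplicates the namespace BY DESIGN (single-problem summit).
set_option linter.dupNamespace false

namespace Summit.RiemannHypothesis.RiemannHypothesis.Theorems.NbGhostOfThePole

/-- **`Assembly` (item stmt-RiemannHypothesis-22978) holds**: the disc zero `ρ_M → 1` makes the sharp floor
exhaust `2π`; the one-term law is conjunct (ii). (Planner rh-idea-3's `assembly_holds`, 6bf12f16.) -/
theorem assembly_proof :
    Summit.RiemannHypothesis.RiemannHypothesis.Theses.NbGhostOfThePole.Assembly := by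
  rintro ⟨M₀, hM₀⟩ h3 h9
  refine ⟨fun ε hε => ?_, h3⟩
  have hπ : 0 < Real.pi := Real.pi_pos
  -- tolerance δ on ‖ρ − 1‖ making the sharp floor ≥ 2π − ε
  set δ : ℝ := min (1 / 8) (ε / (8 * Real.pi)) with hδdef
  have hδpos : 0 < δ := lt_min (by norm_num) (by positivity)
  have hδ8 : δ ≤ 1 / 8 := min_le_left _ _
  have hδε : 8 * Real.pi * δ ≤ ε := by
    calc 8 * Real.pi * δ ≤ 8 * Real.pi * (ε / (8 * Real.pi)) :=
          mul_le_mul_of_nonneg_left (min_le_right _ _) (by positivity)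
      _ = ε := by field_simp
  -- M large enough that the Rouché disc lies within δ of 1: (2π + 1)/log M ≤ δ
  set B : ℝ := (2 * Real.pi + 1) / δ with hBdef
  have hBpos : 0 < B := by positivity
  refine ⟨max M₀ (max 2 ⌈Real.exp B⌉₊), fun M hM N a => ?_⟩
  rw [max_le_iff, max_le_iff] at hM
  obtain ⟨hM0, hM2, hMexp⟩ := hM
  have hMpos : (0 : ℝ) < M := by exact_mod_cast (show 0 < M by omega)
  have hL : B ≤ Real.log M := by
    rw [Real.le_log_iff_exp_le hMpos]
    exact (Nat.le_ceil _).trans (by exact_mod_cast hMexp)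
  have hLpos : 0 < Real.log M := hBpos.trans_le hL
  obtain ⟨ρ, hζ, hρ⟩ := hM₀ M hM0
  -- ‖ρ − 1‖ < δ
  have hnear : ‖ρ - 1‖ < δ := by
    have h1 : ‖ρ - 1‖ ≤ ‖ρ - (1 + 2 * Real.pi / Real.log M * Complex.I)‖ +
        ‖((2 * Real.pi / Real.log M : ℝ) : ℂ) * Complex.I‖ := by
      calc ‖ρ - 1‖ = ‖(ρ - (1 + 2 * Real.pi / Real.log M * Complex.I)) +
            ((2 * Real.pi / Real.log M : ℝ) : ℂ) * Complex.I‖ := by congr 1; push_cast; ring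
        _ ≤ _ := norm_add_le _ _
    have h2 : ‖((2 * Real.pi / Real.log M : ℝ) : ℂ) * Complex.I‖ = 2 * Real.pi / Real.log M := by
      rw [norm_mul, Complex.norm_I, mul_one, Complex.norm_real, Real.norm_eq_abs, abs_of_pos (by positivity)]
    have h4 : 1 / (2 * Real.log M) + 2 * Real.pi / Real.log M ≤ δ := by
      have h3 : 1 / (2 * Real.log M) + 2 * Real.pi / Real.log M ≤ (2 * Real.pi + 1) / Real.log M := by
        rw [div_add_div _ _ (by positivity) hLpos.ne', div_le_div_iff₀ (by positivity) hLpos]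
        nlinarith
      refine h3.trans ?_
      rw [div_le_iff₀ hLpos]
      calc 2 * Real.pi + 1 = B * δ := by rw [hBdef]; field_simp
        _ ≤ Real.log M * δ := mul_le_mul_of_nonneg_right hL hδpos.le
        _ = δ * Real.log M := mul_comm _ _
    linarith [h2 ▸ h1]
  -- consequences: Re ρ > 1 − δ ≥ 7/8 and ‖ρ‖ ≤ 1 + δ
  have hre : 1 - δ < ρ.re := by
    have h1 : |(ρ - 1).re| ≤ ‖ρ - 1‖ := Complex.abs_re_le_norm (ρ - 1)
    rw [Complex.sub_re, Complex.one_re] at h1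
    linarith [(abs_le.mp h1).1]
  have hρhalf : 1 / 2 < ρ.re := by linarith
  have hnorm : ‖ρ‖ ≤ 1 + δ := by
    have : ‖ρ‖ ≤ ‖ρ - 1‖ + ‖(1 : ℂ)‖ := by
      calc ‖ρ‖ = ‖(ρ - 1) + 1‖ := by rw [sub_add_cancel]
        _ ≤ ‖ρ - 1‖ + ‖(1 : ℂ)‖ := norm_add_le _ _
    rw [norm_one] at this
    linarith
  have key : 2 * Real.pi - ε ≤ 2 * Real.pi * (2 * ρ.re - 1) / ‖ρ‖ ^ 2 := by
    have hnorm0 : 0 < ‖ρ‖ := by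
      refine norm_pos_iff.mpr fun h => ?_
      rw [h, Complex.zero_re] at hρhalf
      linarith
    rw [le_div_iff₀ (by positivity)]
    by_cases hε' : 2 * Real.pi - ε ≤ 0
    · exact (mul_nonpos_of_nonpos_of_nonneg hε' (sq_nonneg _)).trans
        (mul_nonneg (by positivity) (by linarith))
    · push Not at hε'
      have hsq : ‖ρ‖ ^ 2 ≤ (1 + δ) ^ 2 := by nlinarith [norm_nonneg ρ]
      have hpoly : (1 - 4 * δ) * (1 + δ) ^ 2 ≤ 1 - 2 * δ := by nlinarith [sq_nonneg δ]
      calc (2 * Real.pi - ε) * ‖ρ‖ ^ 2 ≤ (2 * Real.pi - ε) * (1 + δ) ^ 2 :=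
            mul_le_mul_of_nonneg_left hsq hε'.le
        _ ≤ (2 * Real.pi - 8 * Real.pi * δ) * (1 + δ) ^ 2 :=
            mul_le_mul_of_nonneg_right (by linarith) (by positivity)
        _ = 2 * Real.pi * ((1 - 4 * δ) * (1 + δ) ^ 2) := by ring
        _ ≤ 2 * Real.pi * (1 - 2 * δ) := mul_le_mul_of_nonneg_left hpoly (by positivity)
        _ ≤ 2 * Real.pi * (2 * ρ.re - 1) := mul_le_mul_of_nonneg_left (by linarith) (by positivity)
  exact (ENNReal.ofReal_le_ofReal key).trans (h9 M ρ hζ hρhalf N a)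

end Summit.RiemannHypothesis.RiemannHypothesis.Theorems.NbGhostOfThePole
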